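import Summits.CriticalPhenomena.CardyFormulaZ2.Theses.CardyComplexCone

/-!
# Vocabulary of line `qkz-strip-boundary-arm` for crux `EdgePrecompact` (stmt-CriticalPhenomena-11387)

Route `CardyComplexCone` (sub-problem `CriticalPhenomena/CardyFormulaZ2`), crux
`Summit.CriticalPhenomena.CardyFormulaZ2.Theses.CardyComplexCone.EdgePrecompact` (item
stmt-CriticalPhenomena-11387). This file is the **definitions module** of the checked skeleton
`Cruxes/EdgePrecompact/Lines/qkz-strip-boundary-arm.lean` (planner
`planner-cruxplan-stmt-CriticalPhenomena-11387-qkz-strip-boundary-a-0`, lead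
`prover-line-stmt-CriticalPhenomena-11387-0`, `ledger skeleton check` OK, six registered stubs
`stub_ipExact`, `stub_ipAsymptotic`, `stub_halfArm_le_strip`, `stub_twistedComparison`,
`stub_translationCovariance`, `stub_shiftStability`): it carries, sorry-free, the skeleton's
VOCABULARY — the corner observable `cornerObs` (verbatim the crux integrand), the diagonal strip /
half-plane and their connection events (`diagStrip`, `diagHalfPlane`, `wallConn`, `halfArmEvent`,
`halfArm`), Ikhlef–Ponsaing's product numbers (`vsasm`, `csscpp`, `ipRatio`), translated Dobrushin data
(`shiftData`) and the two intermediate milestones `UniformInnerEnvelope`, `ShiftStability` — so that the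
stub helper files `Theorems/CardyComplexConeEdgePrecompact<StubName>.lean` (each proving
`theorem <stubName> : <signature>` by name, `--supports stmt-CriticalPhenomena-11387`) and the closing
skeleton file share ONE copy of every object. Nothing in this file is asserted: every `def … : Prop` is a
statement to be proved by a registered stub or by the skeleton's glue; the two `theorem`s are the
elementary identities `meshPoint_neg` and `shiftData_shiftData_neg` (registered glue sub-goal, used by the
skeleton's `equicontClause`).

One deliberate deviation from the planner's text: `shiftData` translates the domain and the arcs with
Mathlib's pointwise action `meshPoint E.δ w +ᵥ S` (the form used by the tree's mesh-domain transport
lemmas `mem_meshDomain_vadd`, `discreteDomainGraph_adj_vadd`, `mem_meshBoundary_vadd` of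
`Literature/Probability/LatticeModels/PlanarIsingMeshTranslate.lean`) instead of the image
`(· + meshPoint E.δ w) '' S`; the two sets are equal (`image_add_right_eq_vadd` below), no statement
changes.

Sources: Y. Ikhlef, A. K. Ponsaing, *Finite-size left-passage probability in percolation*, J. Stat.
Phys. 149 (2012) 10–36 (arXiv:1202.5476), Props. 4.5, 4.7, 4.9 (the numbers `A_V`, `N_8`, `P_b`);
S. Smirnov, Ann. of Math. 172 (2010), §2.2 (the parafermionic observable); H. Duminil-Copin,
S. Smirnov, *Conformal invariance of lattice models*, arXiv:1109.1549, §8 (the `q = 1`, spin-`1/3` case).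
-/

namespace Summit.CriticalPhenomena.CardyFormulaZ2.Cruxes.EdgePrecompact.QkzStripBoundaryArm

open MeasureTheory Filter Set Metric
open scoped Topology BigOperators Pointwise
open Literature.Probability.LatticeModels Literature.Probability.Percolation
open Literature.Probability.RandomPlanarGeometry (DobrushinDomain)
open Summit.CriticalPhenomena.CardyFormulaZ2.Theses.CardyComplexCone

noncomputable section

/-! ## Vocabulary -/

/-- The spin-`1/3` CORNER OBSERVABLE of the medial exploration path of the discrete Dobrushin data `E`,
read at mesh `δ`, at the corner (oriented medial edge) `(v, f)`:
`E[ Σ_{k : γ_k = cornerSource v f, γ_{k+1} = cornerTarget v f} exp (−(i/3) · winding (γ[0..k+1])) ]` under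
`P_{1/2}` — VERBATIM the `let E := …` integrand of the crux `EdgePrecompact` (so that `E δ v f` there is
definitionally `cornerObs (Λ δ) δ v f`). (Smirnov 2010, §2.2, eq. (2.2) at spin `1/3`; Duminil-Copin–Smirnov
2012, §8.) -/
def cornerObs (E : DiscreteDobrushin) (δ : ℝ) (v f : Site 2) : ℂ :=
  ∫ ω, (let γ := Literature.Probability.LatticeModels.medialExploration E ω;
    ∑ k ∈ (Finset.range γ.length).filter (fun k => γ[k]? = some
      (Literature.Probability.LatticeModels.cornerSource v f) ∧ γ[k + 1]? = some
      (Literature.Probability.LatticeModels.cornerTarget v f)), Complex.exp (-(Complex.I / 3) *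
      ((Literature.Probability.LatticeModels.winding ((γ.map
      (Literature.Probability.LatticeModels.medialPoint δ)).take (k + 2)) : ℝ) : ℂ)))
    ∂(Literature.Probability.Percolation.bondPercolation (Literature.Probability.LatticeModels.zdGraph 2)
      Literature.Probability.Percolation.half)

/-- The DIAGONAL STRIP of width `n`: sites with `0 ≤ x₀ + x₁ ≤ n`. Its two faces are the lattice
diagonals `x₀ + x₁ = 0` (the WIRED wall below) and `x₀ + x₁ = n` (the free face); every edge of `ℤ²` with
both endpoints in the strip joins the levels `u` and `u+1` — these are the `n` columns of Temperley–Lieb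
tiles of the width-`n` strip of the medial lattice (Ikhlef–Ponsaing 2012, §2.2, Fig. 3). -/
def diagStrip (n : ℕ) : Set (Site 2) := {x | 0 ≤ x 0 + x 1 ∧ x 0 + x 1 ≤ n}

/-- The DIAGONAL HALF-PLANE `0 ≤ x₀ + x₁`. -/
def diagHalfPlane : Set (Site 2) := {x | 0 ≤ x 0 + x 1}

/-- The event "`b` is joined to the wired wall `{x₀ + x₁ = 0}` by an open path inside the diagonal strip
of width `n`" (for `b₀ + b₁ = n − 1` and `n` odd: the infinite hull of the wired/free medial strip passes
the first cut-site at the height of `b` — see the skeleton's `stub_ipExact`). -/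
def wallConn (n : ℕ) (b : Site 2) : Set (BondConfig (Site 2)) :=
  {ω | ∃ w : Site 2, w 0 + w 1 = 0 ∧ ω ∈ openConnIn (diagStrip n) b w}

/-- The DIAGONAL HALF-PLANE ONE-ARM EVENT to depth `n`: the wall site `0` is joined inside the half-plane
`0 ≤ x₀ + x₁` to a site of diagonal depth `≥ n`. -/
def halfArmEvent (n : ℕ) : Set (BondConfig (Site 2)) :=
  {ω | ∃ y : Site 2, (n : ℤ) ≤ y 0 + y 1 ∧ ω ∈ openConnIn diagHalfPlane 0 y}

/-- `halfArm n = P_{1/2}(halfArmEvent n)`: the diagonal half-plane one-arm probability to depth `n` of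
bond percolation on `ℤ²` at `p = 1/2` — the reference boundary quantity `p⁺₁(n)` of this line
(conjecturally `≍ n^{-1/3}`; only `≲` is claimed, by the skeleton's `halfArm_bound`). -/
def halfArm (n : ℕ) : ℝ :=
  (bondPercolation (zdGraph 2) half).real (halfArmEvent n)

/-- `A_V(2m+1)`, the number of vertically symmetric alternating sign matrices of size `2m+1`
(Ikhlef–Ponsaing 2012, Prop. 4.7): `∏_{i<m} (3i+2)(6i+3)!(2i+1)! / ((4i+2)!(4i+3)!)` = 1, 1, 3, 26, 646, … -/
def vsasm (m : ℕ) : ℝ :=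
  ∏ i ∈ Finset.range m, ((3 * i + 2 : ℕ) * (6 * i + 3).factorial * (2 * i + 1).factorial : ℝ) /
    ((4 * i + 2).factorial * (4 * i + 3).factorial : ℝ)

/-- `N_8(2m)`, the number of cyclically symmetric self-complementary plane partitions in a `2m`-cube
(Ikhlef–Ponsaing 2012, Prop. 4.7): `∏_{i<m} (3i+1)(6i)!(2i)! / ((4i)!(4i+1)!)` = 1, 1, 2, 11, 170, 7429, … -/
def csscpp (m : ℕ) : ℝ :=
  ∏ i ∈ Finset.range m, ((3 * i + 1 : ℕ) * (6 * i).factorial * (2 * i).factorial : ℝ) /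
    ((4 * i).factorial * (4 * i + 1).factorial : ℝ)

/-- Ikhlef–Ponsaing's first-site passage probability of the width-`(2m+1)` strip at the percolation point,
`P_b(2m+1) = A_V(2m+1) A_V(2m+3) / N_8(2m+2)²` (IP12 Prop. 4.7) = 1, 3/4, 78/121, 247/425, … -/
def ipRatio (m : ℕ) : ℝ := vsasm m * vsasm (m + 1) / csscpp (m + 1) ^ 2

/-- Dobrushin data translated by the lattice vector `w` (at its own mesh): domain and both arcs moved by
`meshPoint E.δ w` (Mathlib's pointwise action `+ᵥ` on sets), same mesh. A same-class pair of corners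
`(v,f)`, `(v+w,f+w)` is related by this symmetry. -/
def shiftData (E : DiscreteDobrushin) (w : Site 2) : DiscreteDobrushin where
  Ω := meshPoint E.δ w +ᵥ E.Ω
  δ := E.δ
  arcA := meshPoint E.δ w +ᵥ E.arcA
  arcB := meshPoint E.δ w +ᵥ E.arcB

/-- UNIFORM INNER ENVELOPE (the junction of the line): one constant `C` such that for every Jordan
Dobrushin domain `D`, every ℤ²-admissible discretisation `E` of it (arbitrary admissible arcs, any mesh)
and every corner `(v,f)` at lattice depth at least `R ≥ 1` (`R · δ ≤ dist(δv, Dᶜ)`),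
`‖cornerObs E δ v f‖ ≤ C · R^{-1/3}`. A statement to be proved (skeleton: from `stub_twistedComparison` and
the `halfArm` bound), not asserted here. -/
def UniformInnerEnvelope : Prop :=
  ∃ C : ℝ, ∀ (D : DobrushinDomain) (E : DiscreteDobrushin), E.Ω = D.carrier → E.IsZdAdmissible →
    ∀ v f : Site 2, IsCorner v f → ∀ R : ℕ, 1 ≤ R →
    (R : ℝ) * E.δ ≤ infDist (meshPoint E.δ v) D.carrierᶜ →
    ‖cornerObs E E.δ v f‖ ≤ C * (R : ℝ) ^ (-(1:ℝ) / 3)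

/-- SHIFT STABILITY of the corner observable along a discretisation family (the crux's families:
`(Λ δ).Ω = D`, mesh `δ`, eventually admissible): on every compact `K ⊂ D`, for every `ε > 0` there is
`η > 0` such that eventually in `δ`, for every corner `(v,f)` and lattice vector `w` with `δv, δ(v+w) ∈ K`
at distance `< η`, the observable at `(v,f)` of the data `Λ δ` and of its translate by `−w` differ by at
most `ε δ^{1/3}`. With `stub_translationCovariance` this is exactly clause (ii) of the crux (skeleton:
`equicontClause`). A statement to be proved (skeleton: `stub_shiftStability`), not asserted here. -/
def ShiftStability : Prop :=
  ∀ (D : DobrushinDomain) (Λ : ℝ → DiscreteDobrushin),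
    (∀ δ, (Λ δ).Ω = D.carrier) → (∀ δ, (Λ δ).δ = δ) →
    (∀ᶠ δ in 𝓝[>] (0:ℝ), (Λ δ).IsZdAdmissible) →
    ∀ K : Set ℂ, IsCompact K → K ⊆ D.carrier → ∀ ε > (0:ℝ), ∃ η > (0:ℝ), ∀ᶠ δ in 𝓝[>] (0:ℝ),
    ∀ v f w : Site 2, IsCorner v f → meshPoint δ v ∈ K → meshPoint δ (v + w) ∈ K →
    dist (meshPoint δ v) (meshPoint δ (v + w)) < η →
    ‖cornerObs (Λ δ) δ v f - cornerObs (shiftData (Λ δ) (-w)) δ v f‖ ≤ ε * δ ^ ((1:ℝ) / 3)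

/-! ## Elementary glue -/

/-- `meshPoint` is odd: `δ(−w) = −δw`. (buildfix 2026-08-20: the identical lemma is landed as
`DiscretisationFamilyExists.meshPoint_neg'` in `CardySusyWardDiscretisationFamilyExistsTransportC`, already in
this file's import closure; re-exported here under the accepted name instead of re-proved — gate dedup.) -/
alias meshPoint_neg := Summit.CriticalPhenomena.CardyFormulaZ2.Theorems.DiscretisationFamilyExists.meshPoint_neg'

/-- The image of a set under `· + u` is its pointwise translate `u +ᵥ ·` (bridge between the planner's
image form of `shiftData` and the pointwise form used here). -/
theorem image_add_right_eq_vadd (u : ℂ) (S : Set ℂ) : (· + u) '' S = u +ᵥ S := by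
  ext z
  simp only [Set.mem_image, Set.mem_vadd_set, vadd_eq_add]
  constructor
  · rintro ⟨x, hx, rfl⟩
    exact ⟨x, hx, add_comm _ _⟩
  · rintro ⟨x, hx, rfl⟩
    exact ⟨x, hx, add_comm _ _⟩

/-- Shifting the data by `−w` and then by `w` restores them (registered glue sub-goal; used by the
skeleton's `equicontClause`). -/
theorem shiftData_shiftData_neg : ∀ (E : DiscreteDobrushin) (w : Site 2),
    shiftData (shiftData E (-w)) w = E := by
  rintro ⟨Ω, δ, A, B⟩ w
  have key : ∀ S : Set ℂ, meshPoint δ w +ᵥ (meshPoint δ (-w) +ᵥ S) = S := fun S => by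
    rw [vadd_vadd, meshPoint_neg, add_neg_cancel, zero_vadd]
  simp only [shiftData]
  rw [key, key, key]

end

end Summit.CriticalPhenomena.CardyFormulaZ2.Cruxes.EdgePrecompact.QkzStripBoundaryArm

/-! # Vocabulary of line `finitary-green-pairing` for crux `CoherentMorera` (stmt-CriticalPhenomena-11388)

Definitions module of the checked skeleton `Cruxes/CoherentMorera/Lines/finitary_green_pairing.lean` (lead
`prover-line-stmt-CriticalPhenomena-11388-0`; `ledger skeleton check` OK, seven registered stubs
`stub_pairingBound`, `stub_kirchhoff`, `stub_traceIdentity`, `stub_siteRegrouping`, `stub_coherenceShift`,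
`stub_modeSelection`, `stub_precompactTransfer`). It carries the skeleton's vocabulary and the seven stub
STATEMENTS `Sig.stub_*` (each a `def … : Prop` to be PROVED by a helper file
`Theorems/CardyComplexConeCoherentMorera<Stub>.lean`, `--supports stmt-CriticalPhenomena-11388`; nothing is asserted
here). `cornerObs Λ δ (v, f)` is by `rfl` the datum-form `QkzStripBoundaryArm.cornerObs (Λ δ) δ v f` above.
Sources: H. Duminil-Copin, S. Smirnov, Clay Math. Proc. 15 (2012) §8 (Prop. 8.6, Conj. 8.7); H. Duminil-Copin,
*Parafermionic observables and their applications*, arXiv:1208.3787, Prop. 4; S. Smirnov, Ann. Math. 172 (2010) §2.2. -/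

namespace Summit.CriticalPhenomena.CardyFormulaZ2.Cruxes.CoherentMorera.FinitaryGreenPairing

open MeasureTheory Filter Set
open scoped Topology BigOperators
open Literature.Probability.LatticeModels Literature.Probability.Percolation
open Literature.Probability.RandomPlanarGeometry (DobrushinDomain)
open Summit.CriticalPhenomena.CardyFormulaZ2.Theses.CardyComplexCone
-- buildfix lane 2026-08-20: since the 2026-08-15 Literature migration the short name `passageSum` is
-- ambiguous here (`LatticeModels.passageSum` of `FermionicObservable` vs the re-exported copy
-- `MedialPath.passageSum`). Namespace-local alias to the latter — the constant this module's accepted olean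
-- (2026-08-17) and its dependents (`…CoherentMoreraTraceIdentity` etc.) use; namespace resolution precedes
-- the `open`s, so no declaration text changes.
export Literature.Probability.LatticeModels.MedialPath (passageSum)

noncomputable section

/-- Unit lattice vector `e₀`. -/
abbrev e0 : Site 2 := Pi.single 0 1

/-- Unit lattice vector `e₁`. -/
abbrev e1 : Site 2 := Pi.single 1 1

/-- The four corners `(v, f)` at the genuine medial vertex `s(x, x + eᵢ)`, clockwise `NW, NE, SE, SW`
(horizontal: `(x,x), (x+e₀,x), (x+e₀,x−e₁), (x,x−e₁)`; vertical: `(x+e₁,x−e₀), (x+e₁,x), (x,x), (x,x−e₀)`). -/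
def cornersAt (x : Site 2) : Fin 2 → Fin 4 → Site 2 × Site 2
  | 0 => ![(x, x), (x + Pi.single 0 1, x), (x + Pi.single 0 1, x - Pi.single 1 1),
      (x, x - Pi.single 1 1)]
  | 1 => ![(x + Pi.single 1 1, x - Pi.single 0 1), (x + Pi.single 1 1, x), (x, x),
      (x, x - Pi.single 0 1)]

/-- The Duminil-Copin 2012 Prop. 4 vertex relation with chirality `χ = +i` for a corner function `G` at
`s(x, x + eᵢ)`: `G(NW) − G(SE) = i·(G(NE) − G(SW))`. -/
def KirchhoffRel (G : Site 2 × Site 2 → ℂ) (x : Site 2) (i : Fin 2) : Prop :=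
  G (cornersAt x i 0) - G (cornersAt x i 2) = Complex.I * (G (cornersAt x i 1) - G (cornersAt x i 3))

/-- Spin-`1/3` site mode `A₀(v)`: the sum of the four corners of classes `0, −e₀, −e₀−e₁, −e₁` at `v`. -/
def A0 (G : Site 2 × Site 2 → ℂ) (v : Site 2) : ℂ :=
  G (v, v) + G (v, v - e0) + G (v, v - e0 - e1) + G (v, v - e1)

/-- Staggered (spin-`7/3`) site mode `A₂(v)`: the alternating sum of the four corners at `v`. -/
def A2 (G : Site 2 × Site 2 → ℂ) (v : Site 2) : ℂ :=
  G (v, v) - G (v, v - e0) + G (v, v - e0 - e1) - G (v, v - e1)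

/-- `∂̄φ(p)` (verbatim the test-function factor of the crux's clause (i)). -/
def dbar (φ : ℂ → ℂ) (p : ℂ) : ℂ := (fderiv ℝ φ p 1 + Complex.I * fderiv ℝ φ p Complex.I) / 2

/-- `∂φ(p)`. -/
def del (φ : ℂ → ℂ) (p : ℂ) : ℂ := (fderiv ℝ φ p 1 - Complex.I * fderiv ℝ φ p Complex.I) / 2

/-- The `A₀`-pairing against `∂̄φ` at mesh `δ`: `Σ_v A₀(v) ∂̄φ(δv)`. -/
def pair0 (G : Site 2 × Site 2 → ℂ) (φ : ℂ → ℂ) (δ : ℝ) : ℂ :=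
  ∑ᶠ v : Site 2, A0 G v * dbar φ (meshPoint δ v)

/-- The `A₂`-pairing against `∂φ` at mesh `δ`: `Σ_v A₂(v) ∂φ(δv)`. -/
def pair2 (G : Site 2 × Site 2 → ℂ) (φ : ℂ → ℂ) (δ : ℝ) : ℂ :=
  ∑ᶠ v : Site 2, A2 G v * del φ (meshPoint δ v)

/-- The integrand of the corner observable of `EdgeCoherence`/`EdgePrecompact` (verbatim, `Λ δ ↦ E`). -/
def cornerPhase (δ : ℝ) (E : DiscreteDobrushin) (v f : Site 2) (ω : BondConfig (Site 2)) : ℂ :=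
  (let γ := Literature.Probability.LatticeModels.medialExploration E ω; ∑ k ∈ (Finset.range γ.length).filter (fun k => γ[k]? = some (Literature.Probability.LatticeModels.cornerSource v f) ∧ γ[k + 1]? = some (Literature.Probability.LatticeModels.cornerTarget v f)), Complex.exp (-(Complex.I / 3) * ((Literature.Probability.LatticeModels.winding ((γ.map (Literature.Probability.LatticeModels.medialPoint δ)).take (k + 2)) : ℝ) : ℂ)))

/-- The spin-`1/3` corner observable `E_δ` of the family `Λ` at mesh `δ`, as a function of the corner. -/
def cornerObs (Λ : ℝ → DiscreteDobrushin) (δ : ℝ) : Site 2 × Site 2 → ℂ :=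
  fun c => ∫ ω, cornerPhase δ (Λ δ) c.1 c.2 ω ∂(bondPercolation (zdGraph 2) half)

/-- The spin-`1/3` vertex observable `F_δ` of the family `Λ` (verbatim the `let F` of the crux). -/
def vertexObs (Λ : ℝ → DiscreteDobrushin) (δ : ℝ) (z : MedialVertex) : ℂ :=
  ∫ ω, passageSum (medialExploration (Λ δ) ω) δ (1 / 3) z ∂(bondPercolation (zdGraph 2) half)

/-- `P₀`: the percolation `A₀`-pairing. -/
def P0 (Λ : ℝ → DiscreteDobrushin) (φ : ℂ → ℂ) (δ : ℝ) : ℂ := pair0 (cornerObs Λ δ) φ δ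

/-- `P₂`: the percolation `A₂`-pairing. -/
def P2 (Λ : ℝ → DiscreteDobrushin) (φ : ℂ → ℂ) (δ : ℝ) : ℂ := pair2 (cornerObs Λ δ) φ δ

/-- `P_V`: the crux's vertex pairing `Σ_z F_δ(z) ∂̄φ(z_δ)`. -/
def PV (Λ : ℝ → DiscreteDobrushin) (φ : ℂ → ℂ) (δ : ℝ) : ℂ :=
  ∑ᶠ z : MedialVertex, vertexObs Λ δ z * dbar φ (medialPoint δ z)

/-- `δ^{5/3}·P(δ) → 0` as `δ → 0⁺`. -/
def ScaledNull (P : ℝ → ℂ) : Prop :=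
  Tendsto (fun δ : ℝ => ((δ ^ ((5:ℝ) / 3) : ℝ) : ℂ) * P δ) (𝓝[>] (0:ℝ)) (𝓝 0)

/-- The family guards (domain, mesh, eventual admissibility). -/
def Guards (D : DobrushinDomain) (Λ : ℝ → DiscreteDobrushin) : Prop :=
  (∀ δ, (Λ δ).Ω = D.carrier) ∧ (∀ δ, (Λ δ).δ = δ) ∧ (∀ᶠ δ in 𝓝[>] (0:ℝ), (Λ δ).IsZdAdmissible)

/-- Admissible test functions of clause (i). -/
def TestFn (D : DobrushinDomain) (φ : ℂ → ℂ) : Prop :=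
  ContDiff ℝ (⊤ : ℕ∞) φ ∧ HasCompactSupport φ ∧ tsupport φ ⊆ D.carrier

/-- The trace identity in expectation, eventually on compacts: `2cos(π/12)·F_δ(s(x,x+eᵢ)) = Σ_k E_δ(cornersAt x i k)`. -/
def TraceIdentityOn (D : DobrushinDomain) (Λ : ℝ → DiscreteDobrushin) : Prop :=
  ∀ K : Set ℂ, IsCompact K → K ⊆ D.carrier → ∀ᶠ δ in 𝓝[>] (0:ℝ), ∀ (x : Site 2) (i : Fin 2),
    medialPoint δ s(x, x + Pi.single i 1) ∈ K →
      ((2 * Real.cos (Real.pi / 12) : ℝ) : ℂ) * vertexObs Λ δ s(x, x + Pi.single i 1) =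
        ∑ k : Fin 4, cornerObs Λ δ (cornersAt x i k)

/-- Clause (ii) of the crux at one family. -/
def VertexPrecompactAt (D : DobrushinDomain) (Λ : ℝ → DiscreteDobrushin) : Prop :=
  ∀ K : Set ℂ, IsCompact K → K ⊆ D.carrier →
    (∃ C : ℝ, ∀ᶠ δ in 𝓝[>] (0:ℝ), ∀ z : MedialVertex, z ∈ (zdGraph 2).edgeSet →
      medialPoint δ z ∈ K → ‖vertexObs Λ δ z‖ ≤ C * δ ^ ((1:ℝ) / 3)) ∧
    (∀ ε > (0:ℝ), ∃ η > (0:ℝ), ∀ᶠ δ in 𝓝[>] (0:ℝ), ∀ z z' : MedialVertex,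
      z ∈ (zdGraph 2).edgeSet → z' ∈ (zdGraph 2).edgeSet → medialPoint δ z ∈ K →
        medialPoint δ z' ∈ K → dist (medialPoint δ z) (medialPoint δ z') < η →
          ‖vertexObs Λ δ z - vertexObs Λ δ z'‖ ≤ ε * δ ^ ((1:ℝ) / 3))

/-- The matrix of `EdgeCoherence` with the class vector `u` free (verbatim the body of the route decl). -/
def EdgeCoherenceWith (u : Site 2 → ℂ) : Prop :=
  ∀ (D : Literature.Probability.RandomPlanarGeometry.DobrushinDomain) (Λ : ℝ → Literature.Probability.LatticeModels.DiscreteDobrushin), (∀ δ, (Λ δ).Ω = D.carrier) → (∀ δ, (Λ δ).δ = δ) → (∀ᶠ δ in nhdsWithin (0:ℝ) (Set.Ioi 0), (Λ δ).IsZdAdmissible) → let E : ℝ → Literature.Probability.LatticeModels.Site 2 → Literature.Probability.LatticeModels.Site 2 → ℂ := fun δ v f => ∫ ω, (let γ := Literature.Probability.LatticeModels.medialExploration (Λ δ) ω; ∑ k ∈ (Finset.range γ.length).filter (fun k => γ[k]? = some (Literature.Probability.LatticeModels.cornerSource v f) ∧ γ[k + 1]? = some (Literature.Probability.LatticeModels.cornerTarget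 v f)), Complex.exp (-(Complex.I / 3) * ((Literature.Probability.LatticeModels.winding ((γ.map (Literature.Probability.LatticeModels.medialPoint δ)).take (k + 2)) : ℝ) : ℂ))) ∂(Literature.Probability.Percolation.bondPercolation (Literature.Probability.LatticeModels.zdGraph 2) Literature.Probability.Percolation.half); ∀ K : Set ℂ, IsCompact K → K ⊆ D.carrier → ∀ ε > (0:ℝ), ∀ᶠ δ in nhdsWithin (0:ℝ) (Set.Ioi 0), ∀ v f f' : Literature.Probability.LatticeModels.Site 2, Literature.Probability.LatticeModels.IsCorner v f → Literature.Probability.LatticeModels.IsCorner v f' → Literature.Probability.LatticeModels.meshPoint δ v ∈ K → ‖u (f' - v) * E δ v f - u (f - v) * E δ v f'‖ ≤ ε * δ ^ ((1:ℝ) / 3)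

/-- The `ℤ₄` shift of corner classes of the quarter turn `R(a,b) = (−b,a)` (faces re-indexed by `Rf − e₀`):
`classShift o = R o − e₀`, cycling `0 ↦ −e₀ ↦ −e₀−e₁ ↦ −e₁ ↦ 0`. -/
def classShift (o : Site 2) : Site 2 := ![-(o 1), o 0] - e0

/-- STUB 1 statement — summation by parts: for `φ ∈ C_c^∞` with `tsupport φ ⊆ U` open there are `C, δ₀` such
that every corner function bounded by `M` obeying `KirchhoffRel` at the medial vertices with medial point in
`U` has `‖pair0 G φ δ − i·pair2 G φ δ‖ ≤ C·M/δ` for `0 < δ ≤ δ₀`. -/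
def Sig.stub_pairingBound : Prop :=
  ∀ (U : Set ℂ), IsOpen U → ∀ (φ : ℂ → ℂ), ContDiff ℝ (⊤ : ℕ∞) φ → HasCompactSupport φ →
    tsupport φ ⊆ U →
      ∃ C : ℝ, ∃ δ₀ : ℝ, 0 < δ₀ ∧ ∀ δ : ℝ, 0 < δ → δ ≤ δ₀ →
        ∀ (G : Site 2 × Site 2 → ℂ) (M : ℝ), 0 ≤ M → (∀ c, ‖G c‖ ≤ M) →
          (∀ (x : Site 2) (i : Fin 2), medialPoint δ s(x, x + Pi.single i 1) ∈ U →
              KirchhoffRel G x i) →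
            ‖pair0 G φ δ - Complex.I * pair2 G φ δ‖ ≤ C * M / δ

/-- STUB 2 statement — Kirchhoff (DC12 Prop. 4, `χ = +i`) for the percolation corner observable, in
expectation, eventually on compacts of a Jordan Dobrushin domain. -/
def Sig.stub_kirchhoff : Prop :=
  ∀ (D : DobrushinDomain) (Λ : ℝ → DiscreteDobrushin), Guards D Λ →
    ∀ K : Set ℂ, IsCompact K → K ⊆ D.carrier →
      ∀ᶠ δ in 𝓝[>] (0:ℝ), ∀ (x : Site 2) (i : Fin 2),
        medialPoint δ s(x, x + Pi.single i 1) ∈ K → KirchhoffRel (cornerObs Λ δ) x i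

/-- STUB 3 statement — the trace identity in expectation, eventually on compacts. -/
def Sig.stub_traceIdentity : Prop :=
  ∀ (D : DobrushinDomain) (Λ : ℝ → DiscreteDobrushin), Guards D Λ → TraceIdentityOn D Λ

/-- STUB 4 statement — site regrouping: under the trace identity, the vertex pairing and the `A₀` pairing
are `δ^{5/3}`-null together. -/
def Sig.stub_siteRegrouping : Prop :=
  ∀ (D : DobrushinDomain) (Λ : ℝ → DiscreteDobrushin), Guards D Λ → TraceIdentityOn D Λ →
    ∀ φ : ℂ → ℂ, TestFn D φ → (ScaledNull (PV Λ φ) ↔ ScaledNull (P0 Λ φ))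

/-- STUB 5 statement — coherence shift (quarter-turn covariance + universality). -/
def Sig.stub_coherenceShift : Prop :=
  ∀ u : Site 2 → ℂ, EdgeCoherenceWith u → EdgeCoherenceWith (fun o => u (classShift o))

/-- STUB 6 statement — mode selection: two coherence vectors `u`, `u ∘ classShift` with `u ≠ 0` on a class
make `δ^{5/3}P₀ → 0` or `δ^{5/3}P₂ → 0` for every guarded family and test function. -/
def Sig.stub_modeSelection : Prop :=
  ∀ u : Site 2 → ℂ, (∃ o : Site 2, IsCorner 0 o ∧ u o ≠ 0) →
    EdgeCoherenceWith u → EdgeCoherenceWith (fun o => u (classShift o)) →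
      ∀ (D : DobrushinDomain) (Λ : ℝ → DiscreteDobrushin), Guards D Λ →
        ∀ φ : ℂ → ℂ, TestFn D φ → (ScaledNull (P0 Λ φ) ∨ ScaledNull (P2 Λ φ))

/-- STUB 7 statement — precompact transfer (clause (ii) from `EdgePrecompact` and the trace identity). -/
def Sig.stub_precompactTransfer : Prop :=
  EdgePrecompact → ∀ (D : DobrushinDomain) (Λ : ℝ → DiscreteDobrushin), Guards D Λ →
    TraceIdentityOn D Λ → VertexPrecompactAt D Λ

/-! ## Elementary glue -/

/-- `classShift` has order four on `ℤ²` (the quarter turn composed with the face re-indexing is a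
4-cycle on offsets): registered glue sub-goal of the line, used by the provers of `stub_coherenceShift`
(iterating a covariance stated with `classShift⁻¹ = classShift³`) and `stub_modeSelection` (`λ⁴ = 1`). -/
theorem classShift_iter_four : ∀ o : Site 2, classShift (classShift (classShift (classShift o))) = o := by
  intro o
  ext i
  fin_cases i <;> simp [classShift, e0]

end

end Summit.CriticalPhenomena.CardyFormulaZ2.Cruxes.CoherentMorera.FinitaryGreenPairing
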